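import Literature.Analysis.FluidPDE.NSLerayBlowupRateHolds
import Literature.Analysis.FluidPDE.NSWeakStrongUniquenessProofs
import Literature.Analysis.FluidPDE.NSSerrinRegularityProofs
import Literature.Analysis.FluidPDE.WholeSpaceIBP
import HarnessLib

/-!
# Leray's blow-up rate for the ENSTROPHY: `∫ |∇u(t)|² ≥ c ν^{3/2} (T − t)^{−1/2}`

Analysis/FluidPDE proofs file (theorems only).  The tree's `leray_blowup_rate_holds` (Leray 1934 §19, (3.9) /
Ożański–Pooley 2018 Cor. 6.25; Robinson–Rodrigo–Sadowski 2016 Cor. 6.25) gives, for a maximal smooth Leray–Hopf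
solution with blow-up time `T`, the rates `‖u(t)‖_{L^r} ≥ c_r ν^{(r+3)/(2r)} (T − t)^{−(r−3)/(2r)}`, `r > 3`.  With
`r = 6` and the Sobolev inequality `‖u‖_{L⁶(ℝ³)} ≤ K ‖∇u‖_{L²}` (`exists_eLpNorm_six_le_of_hasWeakGradient_euclidean`)
this is Leray's ENSTROPHY rate (Leray 1934 §20, (3.14); Robinson–Rodrigo–Sadowski 2016, Lemma 6.13 / Cor. 6.26):

* `leray_blowup_rate_enstrophy` — `∫ |∇u(t)|²_F ≥ c ν^{3/2} (T − t)^{−1/2}` for all `t ∈ [0, T)`, one universal `c`.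

Use: the quantitative companion of `…NSForcedH1ContinuationOfLerayRate.enstrophy_unbounded_of_maximal`; it is the
rate that a strain-eigenvalue condition `λ₂⁺ ≤ ε/(T−t)` (enstrophy growth `≲ (T−t)^{−4ε}`,
`MillerMiddleEigenvalueSupGronwall`) must beat (nsreg-p1 ROUND-15 rung (ii)).
References: Leray 1934 §§19–20 [Leray1934]; Robinson–Rodrigo–Sadowski 2016, Lemma 6.13, Cor. 6.25
[RobinsonRodrigoSadowski2016].
-/

noncomputable section
open MeasureTheory Set Function Filter Topology
open scoped ENNReal NNReal

namespace Literature.Analysis.FluidPDE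

/-- **Leray's blow-up rate for the enstrophy** (Leray 1934, §20 (3.14); RRS 2016 Lemma 6.13): there is a universal
`c > 0` such that for every maximal smooth solution of the unforced Navier–Stokes system with blow-up time `T`
which is Leray–Hopf from its datum and bounded on closed sub-slabs,
`c ν^{3/2} (T − t)^{−1/2} ≤ ∫ |∇u(t)|²_F` for every `t ∈ [0, T)`.
[cite: Leray1934, §20 (3.14)] [cite: RobinsonRodrigoSadowski2016, Lemma 6.13] -/
theorem leray_blowup_rate_enstrophy :
    ∃ c : ℝ, 0 < c ∧ ∀ (ν T : ℝ), 0 < ν → 0 < T →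
      ∀ (u : ℝ → EuclideanSpace ℝ (Fin 3) → EuclideanSpace ℝ (Fin 3))
        (p : ℝ → EuclideanSpace ℝ (Fin 3) → ℝ),
      FluidPDE.IsMaximalSmoothSolution ν 0 u p T → FluidPDE.IsLerayHopfOn T ν 0 (u 0) u →
      (∀ T' ∈ Ioo 0 T, eLpNorm (uncurry u) ∞ (volume.restrict (Icc 0 T' ×ˢ univ)) < ∞) →
      ∀ t ∈ Ico 0 T,
        ENNReal.ofReal (c * ν ^ (3 / 2 : ℝ) * (T - t) ^ (-(1 / 2 : ℝ))) ≤
          ∫⁻ x, ENNReal.ofReal (FluidPDE.frobeniusNormSq (fderiv ℝ (u t) x)) := by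
  obtain ⟨c₆, hc₆, h6⟩ := leray_blowup_rate_holds 6 (by norm_num)
  obtain ⟨K, hK⟩ := exists_eLpNorm_six_le_of_hasWeakGradient_euclidean
  -- the constant `c = (c₆/(K+1))²`
  refine ⟨(c₆ / (K + 1)) ^ 2, by positivity, fun ν T hν hT u p hmax hLH hbd t ht => ?_⟩
  have hK1 : (0 : ℝ) < K + 1 := by positivity
  have hcl := hmax.isClassicalNSSolutionOn
  have hcont : ContDiff ℝ 1 (u t) := (hcl.contDiff_velocity ht).of_le (by norm_cast)
  -- `u t ∈ L²` (Leray–Hopf energy inequality)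
  have h2 : MemLp (u t) 2 volume := by
    refine ⟨hcont.continuous.aestronglyMeasurable, ?_⟩
    rw [eLpNorm_eq_lintegral_rpow_enorm_toReal (by norm_num) (by norm_num)]
    refine ENNReal.rpow_lt_top_of_nonneg (by norm_num) (ne_of_lt ?_)
    have hE := hLH.eEnergy_le_datum hν.le ⟨ht.1, ht.2.le⟩
    have hlt : ∫⁻ x, ‖u t x‖ₑ ^ 2 < ⊤ := lt_of_le_of_lt hE ENNReal.ofReal_lt_top
    simpa using hlt
  have hw := hasWeakGradient_fderiv_of_contDiff hcont
  set E : ℝ≥0∞ := ∫⁻ x, ENNReal.ofReal (FluidPDE.frobeniusNormSq (fderiv ℝ (u t) x)) with hE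
  -- Leray's `L⁶` rate and the Sobolev inequality
  have hrate := h6 ν T hν hT u p hmax hLH hbd t ht
  have hexp1 : ((6 : ℝ) + 3) / (2 * 6) = 3 / 4 := by norm_num
  have hexp2 : -(((6 : ℝ) - 3) / (2 * 6)) = -(1 / 4) := by norm_num
  rw [hexp1, hexp2] at hrate
  have h6eq : ENNReal.ofReal (6 : ℝ) = 6 := by norm_num
  rw [h6eq] at hrate
  have hsob := hK (u t) _ h2 hw
  -- `ofReal (c₆ ν^{3/4} (T-t)^{-1/4}) ≤ (K+1) E^{1/2}`
  have hchain : ENNReal.ofReal (c₆ * ν ^ (3 / 4 : ℝ) * (T - t) ^ (-(1 / 4 : ℝ))) ≤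
      ((K + 1 : ℝ≥0) : ℝ≥0∞) * E ^ (1 / 2 : ℝ) := by
    refine (hrate.trans hsob).trans ?_
    gcongr
    exact_mod_cast le_add_of_nonneg_right zero_le_one
  -- square both sides
  have hTt : 0 < T - t := sub_pos.2 ht.2
  have hA0 : 0 ≤ c₆ * ν ^ (3 / 4 : ℝ) * (T - t) ^ (-(1 / 4 : ℝ)) := by positivity
  have hsq := pow_le_pow_left' hchain 2
  rw [mul_pow, ← ENNReal.rpow_natCast (E ^ (1 / 2 : ℝ)) 2, ← ENNReal.rpow_mul] at hsq
  norm_num at hsq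
  -- `hsq : ofReal(A)^2 ≤ (K+1)^2 * E`
  have hK2 : (((K + 1 : ℝ≥0) : ℝ≥0∞) ^ 2) ≠ 0 := by positivity
  have hK2' : (((K + 1 : ℝ≥0) : ℝ≥0∞) ^ 2) ≠ ⊤ := by simp
  have hfinal : ENNReal.ofReal (c₆ * ν ^ (3 / 4 : ℝ) * (T - t) ^ (-(1 / 4 : ℝ))) ^ 2 /
      ((K + 1 : ℝ≥0) : ℝ≥0∞) ^ 2 ≤ E := by
    have hsq' : ENNReal.ofReal (c₆ * ν ^ (3 / 4 : ℝ) * (T - t) ^ (-(1 / 4 : ℝ))) ^ 2 ≤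
        E * ((K + 1 : ℝ≥0) : ℝ≥0∞) ^ 2 := by
      calc _ ≤ ((K : ℝ≥0∞) + 1) ^ 2 * E := hsq
        _ = E * ((K + 1 : ℝ≥0) : ℝ≥0∞) ^ 2 := by push_cast; exact mul_comm _ _
    rw [ENNReal.div_le_iff hK2 hK2']
    exact hsq'
  refine le_trans (le_of_eq ?_) hfinal
  -- identify the constants: `ofReal((c₆/(K+1))² ν^{3/2} (T-t)^{-1/2}) = ofReal(A)² / (K+1)²`
  have hA2 : (c₆ * ν ^ (3 / 4 : ℝ) * (T - t) ^ (-(1 / 4 : ℝ))) ^ 2 =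
      c₆ ^ 2 * ν ^ (3 / 2 : ℝ) * (T - t) ^ (-(1 / 2 : ℝ)) := by
    rw [mul_pow, mul_pow, ← Real.rpow_natCast (ν ^ (3 / 4 : ℝ)) 2, ← Real.rpow_mul hν.le,
      ← Real.rpow_natCast ((T - t) ^ (-(1 / 4 : ℝ))) 2, ← Real.rpow_mul hTt.le]
    norm_num
  have hKc : ((K + 1 : ℝ≥0) : ℝ≥0∞) ^ 2 = ENNReal.ofReal (((K : ℝ) + 1) ^ 2) := by
    rw [← ENNReal.ofReal_coe_nnreal, ← ENNReal.ofReal_pow (NNReal.coe_nonneg _)]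
    norm_cast
  rw [← ENNReal.ofReal_pow hA0, hA2, hKc, ← ENNReal.ofReal_div_of_pos (by positivity)]
  congr 1
  field_simp

end Literature.Analysis.FluidPDE

end
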